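/-
Copyright (c) 2026 the pub-hodgecm-mathlib formalisation cell (harness21).  Prover seat hodgecm-mathlib-K2E3-p17 (g7), Track B «K2-LIT» ∕ h413
(`stmt-HodgeConjecture-24833`), line `K2_E3_EllipticInputs`, unit U12 §L, road «GL-[M6]-sc» (owner K2E3-p23 (g5)), MEMO «M6sc-BLUEPRINT v4» §2 last bullet
«N0 + a.e. normal form»: THE SINGULAR SET `{disc χ_g = 0}` OF `GL₃(F)` IS HAAR-NULL, AND HAAR-A.E. `g ∈ GL₃(F)` IS SPLIT-REGULAR, MIXED-REGULAR OR ELLIPTIC.  2026-09-04.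
-/
import Summits.HodgeConjecture.HodgeConjecture.Theorems.K2E3GL3CharpolyDiscNull                       -- ★ H″4 p858010 (this base, g6): `measure_setOf_discr_charpoly_eq_zero` on `𝔤𝔩₃(F)`
import Summits.HodgeConjecture.HodgeConjecture.Theorems.K2E3GL3ModUniformizerCentralizerTrichotomy   -- ★ B4-1d p857926: (T1)–(T3) normal forms; brings ★ J0 `exists_conj_diagonal_of_card_roots_eq_three`
import Literature.NumberTheory.Weil1964.GLnHaarOfAddHaar                                              -- ★ `exists_lintegral_gl_eq_mul_lintegral` (every Haar of `GL_n(F)` = `c·‖det‖⁻ⁿ dX`)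
import HarnessLib

/-!
# K2_E3 road (h413), §L — brick N0: `μ {g ∈ GL₃(F) | disc χ_g = 0} = 0` for EVERY Haar measure `μ` of `GL₃(F)`, and the a.e. normal-form trichotomy

Cell `pub/hodgecm-mathlib` (D-0151), Track B, seat K2E3-p17 (g7); MEMO «M6sc-BLUEPRINT v4» (K2E3-p23 (g5), 71788858034d55d0) §1 reduction (N0) and §2 last
bullet «N0 + a.e. normal form», taken by lineage (census (v) of K2E3-p17 (g6) 06:47:03Z).  `--supports stmt-HodgeConjecture-24833 --as helper`; THEOREMS ONLY
(no definition ∕ instance ∕ notation ∕ named fact ∕ `sorry`); never imports `Cruxes/…/Lines`.  COUNT-NEUTRAL.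

ROAD.  §1 (any `n`): every Haar measure `ρ` of `GL_n(F)` is `c · ‖det X‖_F^{-n} dX` read through `Units.val` (★ `exists_lintegral_gl_eq_mul_lintegral`), so
the preimage `{g | ↑g ∈ S}` of a `dX`-null set `S ⊆ M_n(F)` is `ρ`-null (`∫ 1_S ‖det‖⁻ⁿ dX ≤ ∫_S ‖det‖⁻ⁿ dX = 0`; no measurability of `S` needed, via
`toMeasurable`), and `dX`-a.e. properties of `X` descend to `ρ`-a.e. properties of `↑g`.  §2 (`n = 3`): with ★ H″4 (`{disc χ_X = 0}` is `μ𝔤`-null on `𝔤𝔩₃(F)`)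
the singular set `{g | disc χ_g = 0}` is `ρ`-null, i.e. `ρ`-a.e. `g` is regular semisimple.  §3 (pure algebra, any field; then a.e.): `disc χ_X ≠ 0` ⇒ exactly one of
THREE NORMAL FORMS — split `X = y · diagonal d · y⁻¹` (`d` injective; ★ J0), mixed `X = y · M(m) · y⁻¹` with `M(m) = [[m₀,m₁,0],[m₂,m₃,0],[0,0,m₄]]` and
`χ_{[[m₀,m₁],[m₂,m₃]]}` irreducible (★ B4-1d (T3)), or `χ_X` irreducible (★ B4-1d (T1)–(T2)) — hence the same trichotomy `ρ`-a.e. on `GL₃(F)`; this is the a.e.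
case split under which the ASM of `sig_K2E3GL3ModUniformizerNonEllEstimates` runs (split ↦ T18-split∕VOL-split, mixed ↦ T18-mixed∕VOL-mixed, elliptic ↦ ★ B3).
[HarishChandra1970, Part VII §3 pp. 71–73 (the regular set `G'` has null complement; reduction to Cartan subgroups)] [HarishChandra1999AdmissibleDistributions, §7]
[WeilBNT1967, Ch. I §4 (Haar measure of `GL_n` over a local field is `‖det‖⁻ⁿ dX`)]
HONEST LABEL: HC_CM is proved only modulo the 7 printed citations (2 remaining named inputs: hLiu418 = stmt-HodgeConjecture-24832, h413 = stmt-HodgeConjecture-24833)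
until rung 0 closes; count-neutral helper.

## Mathlib ∕ tree search
Tree: ★ `Weil1964.GLnHaarOfAddHaar.exists_lintegral_gl_eq_mul_lintegral` (Haar uniqueness on `GL_n(F)` against `‖det‖⁻ⁿ dX`), ★ `measurableEmbedding_generalLinearGroup_val`,
★ H″4 `K2E3GL3CharpolyDiscNull.measure_setOf_discr_charpoly_eq_zero`, ★ J0 `K2E3CubicRationalRootsLocallyConstant.exists_conj_diagonal_of_card_roots_eq_three`,
★ B4-1d `K2E3GL3ModUniformizerCentralizerTrichotomy.{card_roots_charpoly_eq_zero_or_one_or_three, irreducible_charpoly_iff_card_roots_eq_zero,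
exists_conj_leviBlock_irreducible_of_card_roots_eq_one}` (elliptic iff `#roots = 0` is (T2) there — not restated), ★ `K2E3CharpolyRootsPerturbation.separable_of_discr_ne_zero`.  Mathlib: `Measure.toMeasurable`,
`measure_toMeasurable`, `Measure.restrict_eq_zero`, `lintegral_indicator`, `setLIntegral_le_lintegral`, `ae_iff`, `Filter.Eventually.mono`.
Dedup: `rg "discr_charpoly.*IsHaarMeasure|IsHaarMeasure.*charpoly.discr|measure_setOf_coe_mem_eq_zero"` over Literature∕Summits — no hits.

## References
* [HarishChandra1970] Harish-Chandra (notes by G. van Dijk), *Harmonic Analysis on Reductive p-adic Groups*, LNM 162 (1970), Part VII §3.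
* [HarishChandra1999AdmissibleDistributions] Harish-Chandra (DeBacker–Sally), *Admissible Invariant Distributions on Reductive p-adic Groups* (1999), §7.
* [WeilBNT1967] A. Weil, *Basic Number Theory* (1967), Ch. I §4.
-/

set_option autoImplicit false
set_option linter.dupNamespace false

noncomputable section

open MeasureTheory MeasureTheory.Measure Set Matrix Topology Polynomial
open scoped MatrixGroups NNReal ENNReal
open Literature.NumberTheory.Weil1964
open Literature.NumberTheory.GaloisRepresentations.IsNonarchimedeanLocalField
open Literature.NumberTheory.Automorphic
open Summit.HodgeConjecture.HodgeConjecture.Cruxes.H413.K2E3CharpolyRootsPerturbation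
open Summit.HodgeConjecture.HodgeConjecture.Cruxes.H413.K2E3CubicRationalRootsLocallyConstant
open Summit.HodgeConjecture.HodgeConjecture.Cruxes.H413.K2E3GL3ModUniformizerCentralizerTrichotomy

namespace Summit.HodgeConjecture.HodgeConjecture.Cruxes.H413.K2E3GL3CharpolyDiscNullHaar

/-! ## §1  `dX`-null sets of `M_n(F)` pull back to Haar-null sets of `GL_n(F)` -/

section Transfer

variable {F : Type*} [Field F] [ValuativeRel F] [TopologicalSpace F] [IsNonarchimedeanLocalField F]
variable {n : Type*} [Fintype n] [DecidableEq n]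
variable [MeasurableSpace (Matrix n n F)] [BorelSpace (Matrix n n F)] [MeasurableSpace (GL n F)] [BorelSpace (GL n F)]

/-- **A `dX`-null set of matrices is Haar-null in `GL_n(F)`**: if `S ⊆ M_n(F)` has additive-Haar measure `0`, then `{g ∈ GL_n(F) | ↑g ∈ S}` is null for every
Haar measure `ρ` of `GL_n(F)` (Haar of `GL_n(F)` is `c·‖det X‖⁻ⁿ dX`). [cite: WeilBNT1967, Ch. I §4] [cite: HarishChandra1970, Part VII §3] -/
theorem measure_setOf_coe_mem_eq_zero (dX : Measure (Matrix n n F)) [dX.IsAddHaarMeasure] (ρ : Measure (GL n F)) [ρ.IsHaarMeasure]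
    {S : Set (Matrix n n F)} (hS : dX S = 0) : ρ {g : GL n F | (g : Matrix n n F) ∈ S} = 0 := by
  -- replace `S` by a measurable null superset
  set T : Set (Matrix n n F) := toMeasurable dX S with hT
  have hTm : MeasurableSet T := measurableSet_toMeasurable dX S
  have hT0 : dX T = 0 := by rw [hT, measure_toMeasurable, hS]
  refine measure_mono_null (fun g hg => subset_toMeasurable dX S hg) ?_
  show ρ {g : GL n F | (g : Matrix n n F) ∈ T} = 0
  -- `ρ {↑g ∈ T} = ∫ 1_T(↑g) dρ = c ∫_{X unit} 1_T(X) ‖det X‖⁻ⁿ dX ≤ c ∫_T ‖det X‖⁻ⁿ dX = 0`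
  obtain ⟨c, -, hc⟩ := exists_lintegral_gl_eq_mul_lintegral dX ρ
  have hmeas : Measurable (T.indicator fun _ : Matrix n n F => (1 : ℝ≥0∞)) := measurable_const.indicator hTm
  have hpre : MeasurableSet {g : GL n F | (g : Matrix n n F) ∈ T} := hTm.preimage measurableEmbedding_generalLinearGroup_val.measurable
  have hind : ∀ g : GL n F, T.indicator (fun _ : Matrix n n F => (1 : ℝ≥0∞)) (g : Matrix n n F) =
      ({g : GL n F | (g : Matrix n n F) ∈ T} : Set (GL n F)).indicator (fun _ => (1 : ℝ≥0∞)) g := by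
    intro g
    by_cases hg : (g : Matrix n n F) ∈ T
    · rw [indicator_of_mem hg, indicator_of_mem (show g ∈ {g : GL n F | (g : Matrix n n F) ∈ T} from hg)]
    · rw [indicator_of_notMem hg, indicator_of_notMem (show g ∉ {g : GL n F | (g : Matrix n n F) ∈ T} from hg)]
  have h1 : ρ {g : GL n F | (g : Matrix n n F) ∈ T} = ∫⁻ g, T.indicator (fun _ : Matrix n n F => (1 : ℝ≥0∞)) (g : Matrix n n F) ∂ρ := by
    simp_rw [hind]
    rw [lintegral_indicator hpre, setLIntegral_one]
  have h2 : ∫⁻ X in {X : Matrix n n F | IsUnit X},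
      T.indicator (fun _ : Matrix n n F => (1 : ℝ≥0∞)) X * ((normAbs F X.det⁻¹ : ℝ≥0) : ℝ≥0∞) ^ Fintype.card n ∂dX = 0 := by
    refine nonpos_iff_eq_zero.mp ?_
    calc ∫⁻ X in {X : Matrix n n F | IsUnit X}, T.indicator (fun _ : Matrix n n F => (1 : ℝ≥0∞)) X * ((normAbs F X.det⁻¹ : ℝ≥0) : ℝ≥0∞) ^ Fintype.card n ∂dX
        ≤ ∫⁻ X, T.indicator (fun _ : Matrix n n F => (1 : ℝ≥0∞)) X * ((normAbs F X.det⁻¹ : ℝ≥0) : ℝ≥0∞) ^ Fintype.card n ∂dX :=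
          setLIntegral_le_lintegral _ _
      _ = ∫⁻ X, T.indicator (fun X : Matrix n n F => ((normAbs F X.det⁻¹ : ℝ≥0) : ℝ≥0∞) ^ Fintype.card n) X ∂dX := by
          refine lintegral_congr fun X => ?_
          by_cases hX : X ∈ T
          · rw [indicator_of_mem hX, indicator_of_mem hX, one_mul]
          · rw [indicator_of_notMem hX, indicator_of_notMem hX, zero_mul]
      _ = ∫⁻ X in T, ((normAbs F X.det⁻¹ : ℝ≥0) : ℝ≥0∞) ^ Fintype.card n ∂dX := lintegral_indicator hTm _
      _ = 0 := by rw [Measure.restrict_eq_zero.2 hT0, lintegral_zero_measure]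
  rw [h1, hc _ hmeas, h2, mul_zero]

/-- **`dX`-a.e. properties of matrices hold Haar-a.e. on `GL_n(F)`**: if `P X` holds for `dX`-a.e. `X ∈ M_n(F)`, then `P ↑g` holds for `ρ`-a.e. `g ∈ GL_n(F)`,
`ρ` any Haar measure of `GL_n(F)`. [cite: WeilBNT1967, Ch. I §4] [cite: HarishChandra1970, Part VII §3] -/
theorem ae_coe_of_ae (dX : Measure (Matrix n n F)) [dX.IsAddHaarMeasure] (ρ : Measure (GL n F)) [ρ.IsHaarMeasure]
    {P : Matrix n n F → Prop} (h : ∀ᵐ X ∂dX, P X) : ∀ᵐ (g : GL n F) ∂ρ, P (g : Matrix n n F) := by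
  rw [ae_iff] at h ⊢
  exact measure_setOf_coe_mem_eq_zero dX ρ (S := {X : Matrix n n F | ¬P X}) h

end Transfer

/-! ## §2  The singular set `{disc χ_g = 0}` of `GL₃(F)` is Haar-null -/

section DiscNull

variable {F : Type*} [Field F] [ValuativeRel F] [TopologicalSpace F] [IsNonarchimedeanLocalField F]
variable [MeasurableSpace (Matrix (Fin 3) (Fin 3) F)] [BorelSpace (Matrix (Fin 3) (Fin 3) F)]
variable [MeasurableSpace (GL (Fin 3) F)] [BorelSpace (GL (Fin 3) F)]

/-- **(N0) `ρ {g ∈ GL₃(F) | disc χ_g = 0} = 0` for every Haar measure `ρ` of `GL₃(F)`** (★ H″4 on `𝔤𝔩₃(F)` + §1; an auxiliary additive Haar measure of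
`M₃(F)` is chosen inside the proof). [cite: HarishChandra1970, Part VII §3] [cite: HarishChandra1999AdmissibleDistributions, §7] [cite: WeilBNT1967, Ch. I §4] -/
theorem measure_setOf_discr_charpoly_eq_zero (ρ : Measure (GL (Fin 3) F)) [ρ.IsHaarMeasure] :
    ρ {g : GL (Fin 3) F | (g : Matrix (Fin 3) (Fin 3) F).charpoly.discr = 0} = 0 := by
  haveI : T2Space F := (isLocalField F).toT2Space
  haveI : LocallyCompactSpace F := (isLocalField F).toLocallyCompactSpace
  haveI : IsTopologicalRing F := inferInstance
  haveI : LocallyCompactSpace (Matrix (Fin 3) (Fin 3) F) := Pi.locallyCompactSpace_of_finite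
  letI : MeasurableSpace F := borel F
  haveI : BorelSpace F := ⟨rfl⟩
  set dX : Measure (Matrix (Fin 3) (Fin 3) F) := Measure.addHaar with hdX
  exact measure_setOf_coe_mem_eq_zero dX ρ (K2E3GL3CharpolyDiscNull.measure_setOf_discr_charpoly_eq_zero dX)

/-- **(N0, a.e. form) Haar-a.e. `g ∈ GL₃(F)` is regular semisimple: `disc χ_g ≠ 0`.** [cite: HarishChandra1970, Part VII §3] [cite: HarishChandra1999AdmissibleDistributions, §7] -/
theorem ae_discr_charpoly_ne_zero (ρ : Measure (GL (Fin 3) F)) [ρ.IsHaarMeasure] :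
    ∀ᵐ (g : GL (Fin 3) F) ∂ρ, (g : Matrix (Fin 3) (Fin 3) F).charpoly.discr ≠ 0 := by
  rw [ae_iff]
  simp only [not_not]
  exact measure_setOf_discr_charpoly_eq_zero ρ

/-- (N0, conjugation form) for every `x ∈ GL₃(F)`, Haar-a.e. `g` has `disc χ_{x g x⁻¹} ≠ 0` (`χ` is a class function). [cite: HarishChandra1970, Part VII §3] -/
theorem ae_discr_charpoly_conj_ne_zero (ρ : Measure (GL (Fin 3) F)) [ρ.IsHaarMeasure] (x : GL (Fin 3) F) :
    ∀ᵐ (g : GL (Fin 3) F) ∂ρ, ((x * g * x⁻¹ : GL (Fin 3) F) : Matrix (Fin 3) (Fin 3) F).charpoly.discr ≠ 0 := by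
  filter_upwards [ae_discr_charpoly_ne_zero ρ] with g hg
  rwa [Units.val_mul, Units.val_mul, Matrix.coe_units_inv, Matrix.charpoly_units_conj]

end DiscNull

/-! ## §3  The normal-form trichotomy of a regular semisimple element (pure algebra), and Haar-a.e. -/

section NormalForm

variable {K : Type*} [Field K]

/-- **Regular semisimple trichotomy in normal-form currency** (any field `K`, `X ∈ 𝔤𝔩₃(K)` with `disc χ_X ≠ 0`): EITHER `X = y·diagonal d·y⁻¹` with `d`
injective (split: three rational eigenvalues), OR `X = y·M(m)·y⁻¹`, `M(m) = [[m₀,m₁,0],[m₂,m₃,0],[0,0,m₄]]` with `χ_{[[m₀,m₁],[m₂,m₃]]}` irreducible (mixed: one rational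
eigenvalue), OR `χ_X` is irreducible (elliptic).  (`#roots χ_X ∈ {3, 1, 0}` by ★ B4-1d (T1); ★ J0; ★ B4-1d (T3); ★ B4-1d (T2).)
[cite: HarishChandra1970, Part VII §3] [cite: PlatonovRapinchuk1994, §3.3] -/
theorem normalForm_of_discr_ne_zero (X : Matrix (Fin 3) (Fin 3) K) (hD : X.charpoly.discr ≠ 0) :
    (∃ (y : GL (Fin 3) K) (d : Fin 3 → K), Function.Injective d ∧
        X = (y : Matrix (Fin 3) (Fin 3) K) * Matrix.diagonal d * ((y⁻¹ : GL (Fin 3) K) : Matrix (Fin 3) (Fin 3) K)) ∨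
      (∃ (y : GL (Fin 3) K) (m : Fin 5 → K), Irreducible (!![m 0, m 1; m 2, m 3] : Matrix (Fin 2) (Fin 2) K).charpoly ∧
        X = (y : Matrix (Fin 3) (Fin 3) K) * !![m 0, m 1, 0; m 2, m 3, 0; 0, 0, m 4] * ((y⁻¹ : GL (Fin 3) K) : Matrix (Fin 3) (Fin 3) K)) ∨
      Irreducible X.charpoly := by
  have hmon : X.charpoly.Monic := Matrix.charpoly_monic X
  have hdeg : X.charpoly.natDegree = 3 := by rw [Matrix.charpoly_natDegree_eq_dim, Fintype.card_fin]
  have hsep : X.charpoly.Separable := separable_of_discr_ne_zero hmon (by omega) hD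
  rcases card_roots_charpoly_eq_zero_or_one_or_three X with h0 | h1 | h3
  · exact Or.inr (Or.inr ((irreducible_charpoly_iff_card_roots_eq_zero X).2 h0))
  · exact Or.inr (Or.inl (exists_conj_leviBlock_irreducible_of_card_roots_eq_one X hsep h1))
  · exact Or.inl (exists_conj_diagonal_of_card_roots_eq_three X h3 hD)

/-- The three cases are read off from `#roots χ_X`: **split iff `#roots χ_X = 3`** (for `disc χ_X ≠ 0`). [cite: HarishChandra1970, Part VII §3] -/
theorem exists_conj_diagonal_iff_card_roots_eq_three (X : Matrix (Fin 3) (Fin 3) K) (hD : X.charpoly.discr ≠ 0) :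
    (∃ (y : GL (Fin 3) K) (d : Fin 3 → K), Function.Injective d ∧
        X = (y : Matrix (Fin 3) (Fin 3) K) * Matrix.diagonal d * ((y⁻¹ : GL (Fin 3) K) : Matrix (Fin 3) (Fin 3) K)) ↔
      X.charpoly.roots.card = 3 := by
  classical
  constructor
  · rintro ⟨y, d, -, hX⟩
    have hc : X.charpoly = (Matrix.diagonal d).charpoly := by rw [hX, Matrix.coe_units_inv, Matrix.charpoly_units_conj]
    rw [hc, Matrix.charpoly_diagonal, Polynomial.roots_prod _ _ (Finset.prod_ne_zero_iff.2 fun i _ => X_sub_C_ne_zero (d i))]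
    simp [roots_X_sub_C]
  · exact fun h3 => exists_conj_diagonal_of_card_roots_eq_three X h3 hD

variable {F : Type*} [Field F] [ValuativeRel F] [TopologicalSpace F] [IsNonarchimedeanLocalField F]
variable [MeasurableSpace (Matrix (Fin 3) (Fin 3) F)] [BorelSpace (Matrix (Fin 3) (Fin 3) F)]
variable [MeasurableSpace (GL (Fin 3) F)] [BorelSpace (GL (Fin 3) F)]

/-- **(N0 + a.e. normal form) Haar-a.e. `g ∈ GL₃(F)` is regular semisimple AND split-diagonalisable, OR of mixed Levi normal form with irreducible `2 × 2` block,
OR elliptic (`χ_g` irreducible)** — the a.e. case split of MEMO «M6sc-BLUEPRINT v4» §1. [cite: HarishChandra1970, Part VII §3] [cite: HarishChandra1999AdmissibleDistributions, §7] -/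
theorem ae_discr_ne_zero_and_normalForm (ρ : Measure (GL (Fin 3) F)) [ρ.IsHaarMeasure] :
    ∀ᵐ (g : GL (Fin 3) F) ∂ρ, (g : Matrix (Fin 3) (Fin 3) F).charpoly.discr ≠ 0 ∧
      ((∃ (y : GL (Fin 3) F) (d : Fin 3 → F), Function.Injective d ∧
          (g : Matrix (Fin 3) (Fin 3) F) = (y : Matrix (Fin 3) (Fin 3) F) * Matrix.diagonal d * ((y⁻¹ : GL (Fin 3) F) : Matrix (Fin 3) (Fin 3) F)) ∨
        (∃ (y : GL (Fin 3) F) (m : Fin 5 → F), Irreducible (!![m 0, m 1; m 2, m 3] : Matrix (Fin 2) (Fin 2) F).charpoly ∧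
          (g : Matrix (Fin 3) (Fin 3) F) = (y : Matrix (Fin 3) (Fin 3) F) * !![m 0, m 1, 0; m 2, m 3, 0; 0, 0, m 4] * ((y⁻¹ : GL (Fin 3) F) : Matrix (Fin 3) (Fin 3) F)) ∨
        Irreducible (g : Matrix (Fin 3) (Fin 3) F).charpoly) := by
  filter_upwards [ae_discr_charpoly_ne_zero ρ] with g hg
  exact ⟨hg, normalForm_of_discr_ne_zero _ hg⟩

end NormalForm

end Summit.HodgeConjecture.HodgeConjecture.Cruxes.H413.K2E3GL3CharpolyDiscNullHaar

end
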